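import Summits.Ventures.PercRepro.Night2ExcessMassUnsat
import Summits.Ventures.PercRepro.Night2FatFaceCap
import Summits.Ventures.PercRepro.Night2FatFaceInj
import Summits.Ventures.PercRepro.Night2TwoOneArith
import Summits.Ventures.PercRepro.Night2TwoOneSums
import Summits.Ventures.PercRepro.Night2SeriesClassesBases
import Summits.Ventures.PercRepro.Night2ThreeOneFatCells
import Summits.Ventures.PercRepro.Night2ThreeTwoGeneric

/-!
# PercRepro — **THE GENERIC PART OF THE `(7, 5)` CELL `(2, 1)` AT EVERY SIZE** (night-2, gen 24)

The cell `(2, 1)` (`|E ∖ G| = 2`, `1` coloop(s), `ρ = 5`, `capDG = 11/18`) has `cPrimeDGP < 0`.  A middle target has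
`≤ 3` thin covering preimages; with ONE fat closure and every other thin member missing `≥ 7` points its layer-1
request is `≤ Φ/4 + 2·Φ/9 = 119 / 216 < capDG`: no middle target is saturated, the residual capacity is
`≥ 13 / 216`, and the count sum with the chord excess `(19 * (n : ℚ) + 193) / (72 * ((n : ℚ) - 2))` and the one-fat-pair count is `≥ 1` at every
`n ≥ 9` (`Night2TwoOneSums`).  The pattern of `Night2ThreeTwoGeneric` (`L1_le_of_fat_le_gen`,
`localShadowHall_excess_of_count_unsat`).

* **`localShadowHall_twoone_five_generic`** — (LI_G) at every rank-6 flat of the cell `(2, 1)` with a fat 2-cocircuit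
  `{p, x}`, at most one fat thin closure and no thin member missing `3 … 6` points, for every `|G|`.
-/

namespace PercRepro.Shadow

open Finset PerFlat ThmH

variable {α : Type*} [DecidableEq α] {M : Matroid α} [M.Finite]

open scoped Classical in
/-- **THE GENERIC `(2, 1)` CELL AT EVERY SIZE**. -/
theorem localShadowHall_twoone_five_generic {G : Finset α} (hG : G ∈ flatsQ M (5 + 1))
    (hd : (gr M \ G).card = 2) (hk : kColoops M G = 1)
    (hs : ∀ e ∈ gr M, ∀ f ∈ gr M, e ≠ f → rkN M {e, f} = 2) (hl : ∀ e ∈ gr M, M.Indep {e})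
    (hcl : (fatClosures M 5 G 2).card ≤ 1)
    (hsp : ∀ B ∈ thinMembers M 5 G, 2 < (G \ clF M B).card → 7 ≤ (G \ clF M B).card)
    {p x : α} (hpx : p ≠ x) (hK : ∀ a ∈ ({p, x} : Finset α), a ∉ coloops M G)
    (hH₀ : M.eRk ((G \ {p, x} : Finset α) : Set α) ≤ ((5 : ℕ) : ℕ∞)) :
    LocalShadowHall M 5 G := by
  have hk' : kColoops M G + 5 = 5 + 1 := by omega
  have hd' : (gr M \ G).card ≤ 5 := by omega
  by_cases hn : 9 ≤ G.card - kColoops M G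
  swap
  · push Not at hn
    exact localShadowHall_of_lossFair hG hd'
      (fun B hB => absurd (thin_card_bound (ρ := 5) hG hd (by omega) hk' hB) (by omega))
  have hKG : coloops M G ⊆ G := fun y hy => (mem_coloops.1 hy).1
  have hnK : (G \ coloops M G).card = G.card - kColoops M G := by
    rw [Finset.card_sdiff_of_subset hKG, ← kColoops_eq_card_coloops]
  -- the middle targets: `L1 ≤ 119 / 216`
  have hL1 : ∀ S ∈ shadowAt M (5 + 2) 5 (Uq M (5 + 2) 5) G, 5 + 1 ≤ (S \ coloops M G).card →
      L1 M 5 G S ≤ 119 / 216 := by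
    intro S hS hcard
    have hf : ((coverPreimages M (Uq M (5 + 2) 5) G S).filter
        (fun B => B ∉ lay0 M 5 G ∧ (G \ clF M B).card ≤ 2)).card ≤ 1 :=
      (card_fat_coverPreimages_le_card_fatClosures (q := 5) (G := G) (S := S) 2).trans hcl
    have hm₀ : ∀ B ∈ coverPreimages M (Uq M (5 + 2) 5) G S, B ∉ lay0 M 5 G → ¬ (G \ clF M B).card ≤ 2 →
        7 ≤ (G \ clF M B).card := by
      intro B hB hnl hgt
      have hBt : B ∈ thinMembers M 5 G := mem_thinMembers.2 ⟨(mem_coverPreimages.1 hB).1, hnl⟩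
      exact hsp B hBt (by omega)
    have h := L1_le_of_fat_le_gen (d := 2) (ρ := 5) (f := 1) (m₀ := 7) hG hd (by norm_num) hk' hs hl hS hcard
      hf hm₀ (by norm_num)
    have e : (1 : ℚ) * reqDGP 5 2 2 + ((5 : ℕ) - 2 - (1 : ℕ) : ℚ) * reqDGP 5 2 7 = 119 / 216 := by
      unfold reqDGP phiQ; norm_num
    push_cast at h e
    linarith
  have hns : ∀ S ∈ shadowAt M (5 + 2) 5 (Uq M (5 + 2) 5) G, 5 + 1 ≤ (S \ coloops M G).card →
      L1 M 5 G S ≤ capS M 5 G S := by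
    intro S hS hcard
    have h1 := hL1 S hS hcard
    have h2 := capS_ge_one_sub_kColoops (q := 5) hd (subset_G_of_mem_shadowAt hS)
    rw [hk] at h2
    unfold phiQ at h2
    norm_num at h2
    linarith
  have hcap : ∀ S ∈ shadowAt M (5 + 2) 5 (Uq M (5 + 2) 5) G, 5 + 1 ≤ (S \ coloops M G).card →
      (13 / 216 : ℚ) ≤ cap2 M 5 G S := by
    intro S hS hcard
    have h1 := hL1 S hS hcard
    have h2 := capS_ge_one_sub_kColoops (q := 5) hd (subset_G_of_mem_shadowAt hS)
    have h0 := cap2_ge_capS_sub_L1_of_le hG hd' S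
    rw [hk] at h2
    unfold phiQ at h2
    norm_num at h2
    linarith
  set n := G.card - kColoops M G with hn'
  have hc₁ : ({p, x} : Finset α).card = 2 := Finset.card_pair hpx
  refine localShadowHall_excess_of_count_unsat (d := 2) (ρ := 5) hG hd (by norm_num) hk' (by norm_num) hns
    (c'' := (13 / 216 : ℚ)) (by norm_num) hcap (E := (19 * (n : ℚ) + 193) / (72 * ((n : ℚ) - 2))) (excess_twoone_pos hn) ?_
    (cnt := fun s => (cntSeries 5 s [2] : ℚ)) ?_ ?_ ?_
  · intro S _ T hT
    have hT' : T ∈ (S \ coloops M G).powersetCard 5 := by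
      unfold coverBases at hT
      exact (Finset.mem_filter.1 hT).1
    have h := sum_faceLoss_union_le (a := (n : ℚ) / (4 * ((n : ℚ) - 2))) (b := 1 / (4 * ((n : ℚ) - 2))) hG hd (by norm_num)
      hk' (by omega) hs hl (le_of_lt (div_pos one_pos (by linarith [show (9 : ℚ) ≤ (n : ℚ) from by exact_mod_cast hn])))
      (by rw [hnK]; exact chord_twoone hn)
      (by rw [hnK, hk, excessBound_twoone_eq hn]; exact (excess_twoone_pos hn).le) hT'
    rw [hnK, hk, excessBound_twoone_eq hn] at h
    exact h
  · intro s h1 _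
    exact cntSeries_twoone_pos (by omega)
  · intro S hSG
    have h := card_coverBases_le_cntSeries hk' [({p, x} : Finset α)] (List.pairwise_singleton _ _) ?_ ?_ hSG
    · simpa only [List.map_cons, List.map_nil, hc₁] using h
    · intro C hC
      rw [List.mem_singleton] at hC
      rw [hC, hc₁]; omega
    · intro C hC a ha b hb hab
      rw [List.mem_singleton] at hC
      rw [hC] at ha hb
      exact ⟨coloops_subset_sdiff_pair (hK a ha) (hK b hb), pair_cocircuit hH₀ a ha b hb hab⟩
  · exact countSum_twoone hn

end PercRepro.Shadow
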